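import Summits.QuantumFields.YangMills.Theorems.AllWindowsColdBoxBoxHighLineLandauThirdOrder
import Summits.QuantumFields.YangMills.Theorems.AllWindowsColdBoxBoxWindowHighSU2213OfSplit11

/-!
# Route item ⟨stmt-QuantumFields-25580⟩ `BoxWindowMidSU221311` — the MID window `1/13 < θ ≤ 1/11` of the cold box — HOLDS
# (split of ⟨stmt-QuantumFields-24336⟩ by planner ym-idea-2 g19, 2026-08-30T02:44Z; LEAD ym-line-sfw-p2 g79 02:45:01Z «the MID '_holds' is fcl-p3's»; split glue ✓`…OfSplit11` by LEAD g79)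

Seat ym-line-fcl-p3 g27 (cell ym-idea-1).  The route decl `Summit.QuantumFields.YangMills.Theses.AllWindowsColdBox.BoxWindowMidSU221311` is definitionally
`BoxWindowSU22 (1/13) (1/11)` of the line (`∀ A θ, 0 < A → A < θ → θ ≤ 7A → 1/13 < θ → θ ≤ 1/11 → ∃ c > 0, BoxTwoPointDomination SU(2)_fund A θ c`), and
LEAD g79's split glue ✓`Split11.boxWindowMidSU221311_of_sizes (hK3) (hK4)` (over w2 g33's ✓`LandauRung3.boxWindowMid_of_sizes`) at `hK3 := tiltCum3_cutSet_size₀`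
(`…LandauThirdOrder`, this seat) and `hK4 := tiltCum4_cutSet_size` (w4 g30) IS the item, both sizes now discharged.

No definitions; tree only; standard axioms.  HONEST LABEL: this closes the MID sub-window item ⟨25580⟩ ONLY; the HIGH residual ⟨stmt-QuantumFields-25584⟩ `BoxWindowHighSU2211`
(θ > 1/11, RG/Bałaban regime) is DECLARED and NOT attacked; ⟨24336⟩ = MID ∧ HIGH11 and ⟨24004⟩ remain OPEN; route AllWindowsColdBox is DRAFT; **the Yang–Mills mass gap is
NOT proved by this file; no summit is proved by a line.**
-/

set_option autoImplicit false

namespace Summit.QuantumFields.YangMills.Theorems.AllWindowsColdBoxBoxHighLine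

/-- ★★★ **⟨stmt-QuantumFields-25580⟩ — the MID window of the SU(2) cold box HOLDS**: for `0 < A < θ ≤ 7A`, `1/13 < θ ≤ 1/11`, the box two-point domination
`BoxTwoPointDomination SU(2)_fund A θ c` with some `c > 0` (✓`Split11.boxWindowMidSU221311_of_sizes hK3 hK4`, both sizes by name). -/
theorem boxWindowMidSU221311_holds : _root_.Summit.QuantumFields.YangMills.Theses.AllWindowsColdBox.BoxWindowMidSU221311 :=
  Split11.boxWindowMidSU221311_of_sizes tiltCum3_cutSet_size₀ tiltCum4_cutSet_size

end Summit.QuantumFields.YangMills.Theorems.AllWindowsColdBoxBoxHighLine
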